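import Summits.Ventures.PercRepro.SMC4

/-!
# PercRepro — the fifteen partitions of four marked vertices, decidably (typer-2, gen 2)

The certificate layer for `k = 4` (PLAN.md §9 p5's "Part(M)-as-Fintype layer", here for four marked
vertices): a partition `σ : Setoid (Fin 4)` is classified by its six **atoms**
`atoms4 σ = (σ 0 1, σ 0 2, σ 0 3, σ 1 2, σ 1 3, σ 2 3)` (as Booleans), a vector in the 64-element
type `Fin 6 → Bool`, on which every statement below is a finite computation (`decide` over the six
Boolean coordinates):

* `relOf4 v` rebuilds the full relation from the atoms (`relOf4_atoms4`), `IsEquivAtoms4 v` says the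
  atoms are transitive (`isEquivAtoms4_atoms4`: the atoms of a partition are), `mergeAtoms4 v i j` is
  `mergeBlocks` on atoms (`atoms4_mergeBlocks`);
* `rows4 s` = the atoms of the engine row `rgs4 s`, `rowOf4 v : Fin 15` = the row with these atoms
  (`rowOf4_eq_iff`: on transitive atom vectors the rows are exactly the 15 atom vectors),
  `row4 σ = rowOf4 (atoms4 σ)`;
* **`rowOf4_mergeAtoms4_mem`** (64 × 16 cases by `decide`): a proper merge moves the row along
  `singleMerges4`; **`row4_isSingleMerge_mem`** is the same for partitions.
* `mem_partitionEvent_four_pairs`, **`row4_markedPartition_eq_iff`**: `row4 (Π(ω)) = s` iff `ω` lies in the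
  engine row `G.partitionEvent ![a, b, c, d] (rgs4 s)`.

`SMCBridge.lean` uses these to discharge `SMC4Principle` from `SMCPrinciple_holds 4`.
-/

namespace PercRepro

/-! ### Atoms of a partition of `Fin 4` -/

/-- The six unordered pairs of `Fin 4`, in the order `01, 02, 03, 12, 13, 23`. -/
def pair4 : Fin 6 → Fin 4 × Fin 4 := ![(0, 1), (0, 2), (0, 3), (1, 2), (1, 3), (2, 3)]

open Classical in
/-- The atom vector of a partition: `atoms4 σ a = [σ (pair4 a).1 (pair4 a).2]`. -/
noncomputable def atoms4 (σ : Setoid (Fin 4)) : Fin 6 → Bool :=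
  fun a => decide (σ (pair4 a).1 (pair4 a).2)

/-- The full (reflexive, symmetric) relation rebuilt from an atom vector. -/
def relOf4 (v : Fin 6 → Bool) : Fin 4 → Fin 4 → Bool :=
  ![![true, v 0, v 1, v 2], ![v 0, true, v 3, v 4], ![v 1, v 3, true, v 5], ![v 2, v 4, v 5, true]]

open Classical in
/-- The rebuilt relation of the atoms of `σ` is `σ`. -/
theorem relOf4_atoms4 (σ : Setoid (Fin 4)) (i j : Fin 4) :
    relOf4 (atoms4 σ) i j = decide (σ i j) := by
  fin_cases i <;> fin_cases j <;>
    first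
    | rfl
    | exact (decide_eq_true (σ.refl _)).symm
    | exact decide_eq_decide.mpr (Setoid.comm' σ)

/-- Transitivity of an atom vector (decidable). -/
def IsEquivAtoms4 (v : Fin 6 → Bool) : Prop :=
  ∀ x y z : Fin 4, relOf4 v x y = true → relOf4 v y z = true → relOf4 v x z = true

/-- `IsEquivAtoms4` is decidable (unfold and decide the finite conjunction). -/
instance : DecidablePred IsEquivAtoms4 := fun _ => by unfold IsEquivAtoms4; infer_instance

/-- The atoms of a partition are transitive. -/
theorem isEquivAtoms4_atoms4 (σ : Setoid (Fin 4)) : IsEquivAtoms4 (atoms4 σ) := by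
  intro x y z hxy hyz
  rw [relOf4_atoms4] at hxy hyz ⊢
  simp only [decide_eq_true_eq] at hxy hyz ⊢
  exact σ.trans hxy hyz

/-- `mergeBlocks` on atom vectors. -/
def mergeAtoms4 (v : Fin 6 → Bool) (i j : Fin 4) : Fin 6 → Bool := fun a =>
  relOf4 v (pair4 a).1 (pair4 a).2 ||
    (relOf4 v (pair4 a).1 i && relOf4 v j (pair4 a).2) ||
      (relOf4 v (pair4 a).1 j && relOf4 v i (pair4 a).2)

open Classical in
/-- The atoms of a merge are the merge of the atoms. -/
theorem atoms4_mergeBlocks (σ : Setoid (Fin 4)) (i j : Fin 4) :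
    atoms4 (mergeBlocks σ i j) = mergeAtoms4 (atoms4 σ) i j := by
  funext a
  simp only [atoms4, mergeAtoms4, mergeBlocks_rel, relOf4_atoms4]
  simp [Bool.or_assoc]

/-- Every atom vector is the vector of its six coordinates. -/
theorem vec6_eta (v : Fin 6 → Bool) : v = ![v 0, v 1, v 2, v 3, v 4, v 5] := by
  funext a
  fin_cases a <;> rfl

/-! ### The fifteen rows -/

/-- The atom vector of the engine row `rgs4 s`. -/
def rows4 (s : Fin 15) : Fin 6 → Bool := fun a => decide (rgs4 s (pair4 a).1 = rgs4 s (pair4 a).2)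

/-- The row of an atom vector (`0` if none matches). -/
def rowOf4 (v : Fin 6 → Bool) : Fin 15 :=
  ((List.finRange 15).find? fun s => rows4 s = v).getD 0

/-- `rowOf4_eq_iff` on the six Boolean coordinates (the form `decide` evaluates). -/
theorem rowOf4_eq_iff_aux : ∀ b0 b1 b2 b3 b4 b5 : Bool,
    IsEquivAtoms4 ![b0, b1, b2, b3, b4, b5] → ∀ s : Fin 15,
      rowOf4 ![b0, b1, b2, b3, b4, b5] = s ↔ ![b0, b1, b2, b3, b4, b5] = rows4 s := by
  decide

/-- On transitive atom vectors, `rowOf4 v = s` iff `v` is the atom vector of row `s`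
(the fifteen rows are exactly the transitive atom vectors; 64 × 15 cases). -/
theorem rowOf4_eq_iff (v : Fin 6 → Bool) (hv : IsEquivAtoms4 v) (s : Fin 15) :
    rowOf4 v = s ↔ v = rows4 s := by
  rw [vec6_eta v] at hv ⊢
  exact rowOf4_eq_iff_aux _ _ _ _ _ _ hv s

/-- `rowOf4_mergeAtoms4_mem` on the six Boolean coordinates (the form `decide` evaluates). -/
theorem rowOf4_mergeAtoms4_mem_aux : ∀ b0 b1 b2 b3 b4 b5 : Bool,
    IsEquivAtoms4 ![b0, b1, b2, b3, b4, b5] → ∀ i j : Fin 4,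
      relOf4 ![b0, b1, b2, b3, b4, b5] i j = false →
        (rowOf4 ![b0, b1, b2, b3, b4, b5], rowOf4 (mergeAtoms4 ![b0, b1, b2, b3, b4, b5] i j)) ∈
          singleMerges4 := by
  decide

/-- **A proper merge moves the row along `singleMerges4`** (64 × 16 cases). -/
theorem rowOf4_mergeAtoms4_mem (v : Fin 6 → Bool) (hv : IsEquivAtoms4 v) (i j : Fin 4)
    (hij : relOf4 v i j = false) : (rowOf4 v, rowOf4 (mergeAtoms4 v i j)) ∈ singleMerges4 := by
  rw [vec6_eta v] at hv hij ⊢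
  exact rowOf4_mergeAtoms4_mem_aux _ _ _ _ _ _ hv i j hij

/-- The row of a partition. -/
noncomputable def row4 (σ : Setoid (Fin 4)) : Fin 15 := rowOf4 (atoms4 σ)

/-- A proper merge of partitions is a single merge of rows. -/
theorem row4_isSingleMerge_mem {σ τ : Setoid (Fin 4)} (h : IsSingleMerge σ τ) :
    (row4 σ, row4 τ) ∈ singleMerges4 := by
  obtain ⟨i, j, hij, rfl⟩ := h
  unfold row4
  rw [atoms4_mergeBlocks]
  refine rowOf4_mergeAtoms4_mem _ (isEquivAtoms4_atoms4 σ) i j ?_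
  rw [relOf4_atoms4]
  simpa using hij

/-! ### Rows as events of the marked vertices -/

namespace MultiGraph

variable {V E : Type*} (G : MultiGraph V E) {ω : Config E}

/-- Membership in a `k = 4` partition row reduces to the six atoms. -/
theorem mem_partitionEvent_four_pairs (m : Fin 4 → V) (r : Fin 4 → ℕ) :
    ω ∈ G.partitionEvent m r ↔
      ∀ a : Fin 6, (G.Conn ω (m (pair4 a).1) (m (pair4 a).2) ↔ r (pair4 a).1 = r (pair4 a).2) := by
  constructor
  · intro h a
    exact h _ _
  · intro h i j
    have h01 : G.Conn ω (m 0) (m 1) ↔ r 0 = r 1 := h 0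
    have h02 : G.Conn ω (m 0) (m 2) ↔ r 0 = r 2 := h 1
    have h03 : G.Conn ω (m 0) (m 3) ↔ r 0 = r 3 := h 2
    have h12 : G.Conn ω (m 1) (m 2) ↔ r 1 = r 2 := h 3
    have h13 : G.Conn ω (m 1) (m 3) ↔ r 1 = r 3 := h 4
    have h23 : G.Conn ω (m 2) (m 3) ↔ r 2 = r 3 := h 5
    fin_cases i <;> fin_cases j <;>
      first
      | exact ⟨fun _ => rfl, fun _ => Conn.refl G ω _⟩
      | exact h01 | exact h02 | exact h03 | exact h12 | exact h13 | exact h23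
      | exact (G.conn_comm.trans h01).trans eq_comm
      | exact (G.conn_comm.trans h02).trans eq_comm
      | exact (G.conn_comm.trans h03).trans eq_comm
      | exact (G.conn_comm.trans h12).trans eq_comm
      | exact (G.conn_comm.trans h13).trans eq_comm
      | exact (G.conn_comm.trans h23).trans eq_comm

open Classical in
/-- The atoms of the marked partition are the connection atoms. -/
theorem atoms4_markedPartition (m : Fin 4 → V) (a : Fin 6) :
    atoms4 (G.markedPartition ω m) a = decide (G.Conn ω (m (pair4 a).1) (m (pair4 a).2)) := rfl

/-- **The row of the marked partition is `s` iff `ω` lies in the engine row `rgs4 s`.** -/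
theorem row4_markedPartition_eq_iff (m : Fin 4 → V) (s : Fin 15) :
    row4 (G.markedPartition ω m) = s ↔ ω ∈ G.partitionEvent m (rgs4 s) := by
  rw [row4, rowOf4_eq_iff _ (isEquivAtoms4_atoms4 _), G.mem_partitionEvent_four_pairs, funext_iff]
  simp only [atoms4_markedPartition, rows4, decide_eq_decide]

end MultiGraph

end PercRepro
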